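import Mathlib
import HarnessLib
import Literature.Analysis.FluidPDE.SpaceTimeCalculus
import Summits.NavierStokesRegularity.NavierStokesRegularity.Theorems.PoloidalWindowDoorLrcModEntireQ4WebPackage
import Summits.NavierStokesRegularity.NavierStokesRegularity.Theorems.PoloidalWindowDoorLrcModEntireCurvedWebTools
import Summits.NavierStokesRegularity.NavierStokesRegularity.Theorems.PoloidalWindowDoorLrcModEntireTwistingTHFlatRidgeMixedPin

/-!
# Route `PoloidalWindowDoor`, item `LrcModEntire` (stmt-NavierStokesRegularity-20428), cells (Q4-*) of the (TH) column over a STRAIGHT branch —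
# THE SPACE–TIME WEB FUNCTION `n₀(τ,s,z)` (class-free kernel input of the time direction), I: existence and joint smoothness

Cell ns-regularity-ideate, helper seat ns-k2-port-2 g8 under the LEAD of item 20428 (ns-poloidal-K2-p3 g17, 17:52Z «class wiring welcome»);
`--supports stmt-NavierStokesRegularity-20428 --as helper`.  Memo `Cruxes/LrcModEntire/HOT-SHEET-port2g8.md` §3(b),(3g); LEAD g17's TIME DICHOTOMY needs the webs at
`τ ≠ 0`.  The LEAD's `…Q4LineWeb.webFun` is a slice object (`τ = 0`); here, for `F : ℝ → ℝ³ → ℝ` jointly smooth on an open time set `T` and a horizontal frame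
`(e, Je, e₂)`, the space–time cross-section family `((τ,s,z),n) ↦ F τ (s·e + n·Je + z·e₂)` is smooth (`contDiffAt_timeSection`) with fibre derivatives `D(F τ)[Je]`,
`D²(F τ)[Je,Je]` (`fderiv_timeSection_fibre`, `fderiv_fderiv_timeSection_fibre`), and from strict transversal concavity plus the maximiser clause of the (Q4) package:

* ★ `exists_timeWebFunction` — a web function `n₀ : ℝ × ℝ × ℝ → ℝ` on the window `{|τ| < δ, |z| < δ}` carrying the unique strict maximiser, its value `R τ z`,
  `∂_{Je}(F τ) = 0` at the web point, and **`n₀ ∈ C^m` jointly in `(τ,s,z)` for every `m : ℕ∞`** (K2-p2's `…CurvedWebTools.contDiffAt_criticalPoint_of_contDiffAt`).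

The class-level package (web data, ridge law and the Huygens identity at every nearby time) is `…Q4TimeWebPackage.time_web_package_line`.
WHAT THIS IS NOT: not a claim about Navier–Stokes regularity — calculus for the hypothetical web of the research cells (Q4-*) (registry twist_split v11); no stub is
closed here; items 20428 / 19708 / 27893 OPEN.
-/

noncomputable section

set_option linter.dupNamespace false
set_option linter.style.longLine false

namespace Summit.NavierStokesRegularity.NavierStokesRegularity.Theorems.PoloidalWindowDoorLrcModEntireQ4TimeWebFunction

open Set Function Filter Topology Metric
open scoped RealInnerProductSpace InnerProductSpace Laplacian ContDiff
open Literature.Analysis Literature.Analysis.FluidPDE Literature.Analysis.UnboundedOperators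
open Summit.NavierStokesRegularity.NavierStokesRegularity.Theorems
open Summit.NavierStokesRegularity.NavierStokesRegularity.Theorems.LocalSineTubeDoorProfileAlignedWindowRigidityAncient
open Summit.NavierStokesRegularity.NavierStokesRegularity.Theorems.PoloidalWindowDoorLrcModEntireSheetCauchyUniqueness
open Summit.NavierStokesRegularity.NavierStokesRegularity.Theorems.PoloidalWindowDoorLrcModEntireSheetFlattenTools
open Summit.NavierStokesRegularity.NavierStokesRegularity.Theorems.PoloidalWindowDoorLrcModEntireParallelWebsIdentity
open Summit.NavierStokesRegularity.NavierStokesRegularity.Theorems.PoloidalWindowDoorLrcModEntireParallelWebs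
open Summit.NavierStokesRegularity.NavierStokesRegularity.Theorems.PoloidalWindowDoorLrcModEntireRidgeWebImplicit
open Summit.NavierStokesRegularity.NavierStokesRegularity.Theorems.PoloidalWindowDoorLrcModEntireCurvedWebTools
open Summit.NavierStokesRegularity.NavierStokesRegularity.Theorems.PoloidalWindowDoorLrcModEntireQ4LineTools
open Summit.NavierStokesRegularity.NavierStokesRegularity.Theorems.PoloidalWindowDoorLrcModEntireQ4LineWeb
open Summit.NavierStokesRegularity.NavierStokesRegularity.Theorems.PoloidalWindowDoorLrcModEntireQ4WebPackage
open Summit.NavierStokesRegularity.NavierStokesRegularity.Theorems.PoloidalWindowDoorLrcModEntireRidgeWebLaw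
open Summit.NavierStokesRegularity.NavierStokesRegularity.Theorems.PoloidalWindowDoorLrcModEntireRidgeClassConstants
open Summit.NavierStokesRegularity.NavierStokesRegularity.Theorems.PoloidalWindowDoorLrcModEntireRidgeWebLawHoriz
open Summit.NavierStokesRegularity.NavierStokesRegularity.Theorems.PoloidalWindowDoorPoloidalWindowRigidityTimeHeightShearLinearSlice
open Summit.NavierStokesRegularity.NavierStokesRegularity.Theorems.PoloidalWindowDoorPoloidalWindowRigidityConstantShearSlice
open Summit.NavierStokesRegularity.NavierStokesRegularity.Theorems.PoloidalWindowDoorLrcModEntireTwistingTHSlopeSign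
open Summit.NavierStokesRegularity.NavierStokesRegularity.Theorems.PoloidalWindowDoorLrcModEntireTwistingTHFlatRidgeMixedPin

/-! ### Part A — class-free: the space–time cross-section family and the space–time web function -/

section ClassFree

variable {F : ℝ → EuclideanSpace ℝ (Fin 3) → ℝ} {T : Set ℝ} {e : EuclideanSpace ℝ (Fin 3)}

/-- The affine reparametrisation `((τ,s,z),n) ↦ (τ, s·e + n·Je + z·e₂)` as a continuous linear map. -/
theorem timeSection_map_eq (e : EuclideanSpace ℝ (Fin 3)) (v : (ℝ × ℝ × ℝ) × ℝ) :
    ((ContinuousLinearMap.fst ℝ ℝ (ℝ × ℝ)).comp (ContinuousLinearMap.fst ℝ (ℝ × ℝ × ℝ) ℝ)).prod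
        ((frameCLM e).comp
          ((((ContinuousLinearMap.fst ℝ ℝ ℝ).comp (ContinuousLinearMap.snd ℝ ℝ (ℝ × ℝ))).comp (ContinuousLinearMap.fst ℝ (ℝ × ℝ × ℝ) ℝ)).prod
            ((ContinuousLinearMap.snd ℝ (ℝ × ℝ × ℝ) ℝ).prod
              (((ContinuousLinearMap.snd ℝ ℝ ℝ).comp (ContinuousLinearMap.snd ℝ ℝ (ℝ × ℝ))).comp (ContinuousLinearMap.fst ℝ (ℝ × ℝ × ℝ) ℝ))))) v =
      (v.1.1, frameCLM e (v.1.2.1, v.2, v.1.2.2)) := by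
  simp

/-- **The space–time cross-section family is `C^m`** at every `((τ,s,z), n)` with `τ ∈ T` (any `m`). -/
theorem contDiffAt_timeSection (hT : IsOpen T) (hF : IsSmoothSpaceTimeOn T F) {m : ℕ∞} {p : ℝ × ℝ × ℝ} (hp : p.1 ∈ T) (n : ℝ) :
    ContDiffAt ℝ m (fun v : (ℝ × ℝ × ℝ) × ℝ => F v.1.1 (frameCLM e (v.1.2.1, v.2, v.1.2.2))) (p, n) := by
  set A := ((ContinuousLinearMap.fst ℝ ℝ (ℝ × ℝ)).comp (ContinuousLinearMap.fst ℝ (ℝ × ℝ × ℝ) ℝ)).prod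
        ((frameCLM e).comp
          ((((ContinuousLinearMap.fst ℝ ℝ ℝ).comp (ContinuousLinearMap.snd ℝ ℝ (ℝ × ℝ))).comp (ContinuousLinearMap.fst ℝ (ℝ × ℝ × ℝ) ℝ)).prod
            ((ContinuousLinearMap.snd ℝ (ℝ × ℝ × ℝ) ℝ).prod
              (((ContinuousLinearMap.snd ℝ ℝ ℝ).comp (ContinuousLinearMap.snd ℝ ℝ (ℝ × ℝ))).comp (ContinuousLinearMap.fst ℝ (ℝ × ℝ × ℝ) ℝ))))) with hA
  have hfun : (fun v : (ℝ × ℝ × ℝ) × ℝ => F v.1.1 (frameCLM e (v.1.2.1, v.2, v.1.2.2))) = uncurry F ∘ A := by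
    funext v; rw [Function.comp_apply, hA, timeSection_map_eq]; rfl
  rw [hfun]
  have hFat : ContDiffAt ℝ ∞ (uncurry F) (A (p, n)) := by
    rw [hA, timeSection_map_eq]; exact hF.contDiffAt hT hp _
  exact (hFat.of_le (by exact WithTop.coe_le_coe.2 le_top)).comp (p, n) A.contDiff.contDiffAt

/-- **First fibre derivative** of the space–time cross-section family: `D(F τ)(s·e + n·Je + z·e₂)[Je]`. -/
theorem fderiv_timeSection_fibre (hT : IsOpen T) (hF : IsSmoothSpaceTimeOn T F) {p : ℝ × ℝ × ℝ} (hp : p.1 ∈ T) (n : ℝ) :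
    fderiv ℝ (fun v : (ℝ × ℝ × ℝ) × ℝ => F v.1.1 (frameCLM e (v.1.2.1, v.2, v.1.2.2))) (p, n) ((0 : ℝ × ℝ × ℝ), (1 : ℝ)) =
      fderiv ℝ (F p.1) (frameCLM e (p.2.1, n, p.2.2)) (Jvec e) := by
  have hGd : DifferentiableAt ℝ (fun v : (ℝ × ℝ × ℝ) × ℝ => F v.1.1 (frameCLM e (v.1.2.1, v.2, v.1.2.2))) (p, n) :=
    (contDiffAt_timeSection (e := e) hT hF (m := 1) hp n).differentiableAt (by simp)
  have hι : HasDerivAt (fun m : ℝ => ((p, m) : (ℝ × ℝ × ℝ) × ℝ)) ((0 : ℝ × ℝ × ℝ), (1 : ℝ)) n :=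
    (hasDerivAt_const n p).prodMk (hasDerivAt_id n)
  have h1 := hGd.hasFDerivAt.comp_hasDerivAt n hι
  -- the fibre line is the straight cross-section of the slice `F p.1`
  have hFτ : ContDiff ℝ 2 (F p.1) := (hF.contDiff_slice hp).of_le (by exact WithTop.coe_le_coe.2 le_top)
  have hl : HasDerivAt (fun m : ℝ => frameCLM e (p.2.1, m, p.2.2)) (Jvec e) n := by
    have h : HasDerivAt (fun m : ℝ => p.2.1 • e + m • Jvec e + p.2.2 • e2) ((1 : ℝ) • Jvec e) n :=
      (((hasDerivAt_id n).smul_const (Jvec e)).const_add (p.2.1 • e)).add_const (p.2.2 • e2)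
    simpa [frameCLM_apply] using h
  have h2 : HasDerivAt (fun m : ℝ => F p.1 (frameCLM e (p.2.1, m, p.2.2))) (fderiv ℝ (F p.1) (frameCLM e (p.2.1, n, p.2.2)) (Jvec e)) n :=
    ((hFτ.differentiable (by norm_num)) _).hasFDerivAt.comp_hasDerivAt n hl
  exact h1.unique h2

/-- **Second fibre derivative** of the space–time cross-section family: `D²(F τ)(s·e + n·Je + z·e₂)[Je,Je]`. -/
theorem fderiv_fderiv_timeSection_fibre (hT : IsOpen T) (hF : IsSmoothSpaceTimeOn T F) {p : ℝ × ℝ × ℝ} (hp : p.1 ∈ T) (n : ℝ) :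
    fderiv ℝ (fderiv ℝ (fun v : (ℝ × ℝ × ℝ) × ℝ => F v.1.1 (frameCLM e (v.1.2.1, v.2, v.1.2.2)))) (p, n)
        ((0 : ℝ × ℝ × ℝ), (1 : ℝ)) ((0 : ℝ × ℝ × ℝ), (1 : ℝ)) =
      fderiv ℝ (fderiv ℝ (F p.1)) (frameCLM e (p.2.1, n, p.2.2)) (Jvec e) (Jvec e) := by
  have hG2 : ContDiffAt ℝ 2 (fun v : (ℝ × ℝ × ℝ) × ℝ => F v.1.1 (frameCLM e (v.1.2.1, v.2, v.1.2.2))) (p, n) :=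
    contDiffAt_timeSection (e := e) hT hF hp n
  have hGd2 : DifferentiableAt ℝ (fderiv ℝ (fun v : (ℝ × ℝ × ℝ) × ℝ => F v.1.1 (frameCLM e (v.1.2.1, v.2, v.1.2.2)))) (p, n) :=
    (hG2.fderiv_right (m := 1) le_rfl).differentiableAt (by simp)
  have h1 := hasDerivAt_partial_fibre hGd2
  -- near `n` (indeed for all `m`) the fibre partial is the slice cross-section derivative
  have hEq : (fun m : ℝ => fderiv ℝ (fun v : (ℝ × ℝ × ℝ) × ℝ => F v.1.1 (frameCLM e (v.1.2.1, v.2, v.1.2.2))) (p, m)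
      ((0 : ℝ × ℝ × ℝ), (1 : ℝ))) = fun m : ℝ => fderiv ℝ (F p.1) (frameCLM e (p.2.1, m, p.2.2)) (Jvec e) :=
    funext fun m => fderiv_timeSection_fibre hT hF hp m
  rw [hEq] at h1
  have hFτ : ContDiff ℝ 2 (F p.1) := (hF.contDiff_slice hp).of_le (by exact WithTop.coe_le_coe.2 le_top)
  -- second derivative of the straight cross-section of the slice
  have hD1 : ContDiff ℝ 1 (fderiv ℝ (F p.1)) := hFτ.fderiv_right le_rfl
  set B : (EuclideanSpace ℝ (Fin 3) →L[ℝ] ℝ) →L[ℝ] ℝ := ContinuousLinearMap.apply ℝ ℝ (Jvec e) with hB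
  have hφd : ∀ y, HasFDerivAt (fun y => fderiv ℝ (F p.1) y (Jvec e)) (B.comp (fderiv ℝ (fderiv ℝ (F p.1)) y)) y := by
    intro y
    have e1 : (fun y => fderiv ℝ (F p.1) y (Jvec e)) = B ∘ fderiv ℝ (F p.1) := by funext y; simp [hB]
    rw [e1]; exact B.hasFDerivAt.comp y ((hD1.differentiable one_ne_zero) y).hasFDerivAt
  have hl : HasDerivAt (fun m : ℝ => frameCLM e (p.2.1, m, p.2.2)) (Jvec e) n := by
    have h : HasDerivAt (fun m : ℝ => p.2.1 • e + m • Jvec e + p.2.2 • e2) ((1 : ℝ) • Jvec e) n :=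
      (((hasDerivAt_id n).smul_const (Jvec e)).const_add (p.2.1 • e)).add_const (p.2.2 • e2)
    simpa [frameCLM_apply] using h
  have h2 := (hφd _).comp_hasDerivAt n hl
  have e2' : (B.comp (fderiv ℝ (fderiv ℝ (F p.1)) (frameCLM e (p.2.1, n, p.2.2)))) (Jvec e) =
      fderiv ℝ (fderiv ℝ (F p.1)) (frameCLM e (p.2.1, n, p.2.2)) (Jvec e) (Jvec e) := by simp [hB]
  rw [e2'] at h2
  exact h1.unique h2

/-- ★ **THE SPACE–TIME WEB FUNCTION.**  `F` jointly smooth on the open time set `T ⊇ (−δ,δ)`; strict transversal concavity of the straight cross-sections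
`n ↦ F τ (s·e + n·Je + z·e₂)` on `(−r,r)` for `|τ|,|z| < δ`; a unique strict maximiser in `(−r,r)` with height-only value `R τ z` (the web Fermat clause of
the (Q4) package).  Then there is `n₀ : ℝ × ℝ × ℝ → ℝ` on the window carrying the maximiser, with `∂_{Je}(F τ) = 0` at the web point, and `n₀` is `C^m`
jointly in `(τ, s, z)` for every `m : ℕ∞`. -/
theorem exists_timeWebFunction (hT : IsOpen T) (hF : IsSmoothSpaceTimeOn T F) {δ r : ℝ} (hδT : Ioo (-δ) δ ⊆ T)
    (hconc : ∀ τ z : ℝ, |τ| < δ → |z| < δ → ∀ s : ℝ, ∀ n ∈ Ioo (-r) r,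
      fderiv ℝ (fderiv ℝ (F τ)) (frameCLM e (s, n, z)) (Jvec e) (Jvec e) < 0)
    {R : ℝ → ℝ → ℝ}
    (hS : ∀ τ z : ℝ, |τ| < δ → |z| < δ → ∀ s : ℝ, ∃ n₀ ∈ Ioo (-r) r, F τ (frameCLM e (s, n₀, z)) = R τ z ∧
      ∀ n ∈ Icc (-r) r, n ≠ n₀ → F τ (frameCLM e (s, n, z)) < R τ z) :
    ∃ n₀ : ℝ × ℝ × ℝ → ℝ,
      (∀ q : ℝ × ℝ × ℝ, |q.1| < δ → |q.2.2| < δ → n₀ q ∈ Ioo (-r) r ∧ F q.1 (frameCLM e (q.2.1, n₀ q, q.2.2)) = R q.1 q.2.2 ∧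
        ∀ n ∈ Icc (-r) r, n ≠ n₀ q → F q.1 (frameCLM e (q.2.1, n, q.2.2)) < R q.1 q.2.2) ∧
      (∀ q : ℝ × ℝ × ℝ, |q.1| < δ → |q.2.2| < δ → fderiv ℝ (F q.1) (frameCLM e (q.2.1, n₀ q, q.2.2)) (Jvec e) = 0) ∧
      (∀ m : ℕ∞, ∀ q : ℝ × ℝ × ℝ, |q.1| < δ → |q.2.2| < δ → ContDiffAt ℝ m n₀ q) := by
  classical
  -- the window and the chosen maximiser
  set V : Set (ℝ × ℝ × ℝ) := {q | |q.1| < δ ∧ |q.2.2| < δ} with hV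
  have hVo : IsOpen V := (isOpen_lt (continuous_fst.abs) continuous_const).inter
    (isOpen_lt ((continuous_snd.comp continuous_snd).abs) continuous_const)
  set n₀ : ℝ × ℝ × ℝ → ℝ := fun q => if h : |q.1| < δ ∧ |q.2.2| < δ then Classical.choose (hS q.1 q.2.2 h.1 h.2 q.2.1) else 0 with hn₀
  have hspec : ∀ q : ℝ × ℝ × ℝ, |q.1| < δ → |q.2.2| < δ → n₀ q ∈ Ioo (-r) r ∧ F q.1 (frameCLM e (q.2.1, n₀ q, q.2.2)) = R q.1 q.2.2 ∧
      ∀ n ∈ Icc (-r) r, n ≠ n₀ q → F q.1 (frameCLM e (q.2.1, n, q.2.2)) < R q.1 q.2.2 := by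
    intro q h1 h2
    have hq : n₀ q = Classical.choose (hS q.1 q.2.2 h1 h2 q.2.1) := by rw [hn₀]; simp [h1, h2]
    obtain ⟨hin, hval, huniq⟩ := Classical.choose_spec (hS q.1 q.2.2 h1 h2 q.2.1)
    rw [hq]; exact ⟨hin, hval, huniq⟩
  have hT' : ∀ q ∈ V, q.1 ∈ T := fun q hq => hδT ⟨(abs_lt.1 hq.1).1, (abs_lt.1 hq.1).2⟩
  -- criticality: interior maximum of the straight cross-section
  have hcritF : ∀ q ∈ V, fderiv ℝ (F q.1) (frameCLM e (q.2.1, n₀ q, q.2.2)) (Jvec e) = 0 := by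
    intro q hq
    obtain ⟨hin, hval, huniq⟩ := hspec q hq.1 hq.2
    have hloc : IsLocalMax (fun m : ℝ => F q.1 (frameCLM e (q.2.1, m, q.2.2))) (n₀ q) := by
      have hI : Icc (-r) r ∈ 𝓝 (n₀ q) := Icc_mem_nhds hin.1 hin.2
      refine Filter.eventually_of_mem hI fun m hm => ?_
      show F q.1 (frameCLM e (q.2.1, m, q.2.2)) ≤ F q.1 (frameCLM e (q.2.1, n₀ q, q.2.2))
      by_cases hmn : m = n₀ q
      · rw [hmn]
      · rw [hval]; exact (huniq m hm hmn).le
    have hd := hloc.deriv_eq_zero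
    have hFτ : ContDiff ℝ 2 (F q.1) := (hF.contDiff_slice (hT' q hq)).of_le (by exact WithTop.coe_le_coe.2 le_top)
    have hl : HasDerivAt (fun m : ℝ => frameCLM e (q.2.1, m, q.2.2)) (Jvec e) (n₀ q) := by
      have h : HasDerivAt (fun m : ℝ => q.2.1 • e + m • Jvec e + q.2.2 • e2) ((1 : ℝ) • Jvec e) (n₀ q) :=
        (((hasDerivAt_id (n₀ q)).smul_const (Jvec e)).const_add (q.2.1 • e)).add_const (q.2.2 • e2)
      simpa [frameCLM_apply] using h
    have h2 : HasDerivAt (fun m : ℝ => F q.1 (frameCLM e (q.2.1, m, q.2.2))) (fderiv ℝ (F q.1) (frameCLM e (q.2.1, n₀ q, q.2.2)) (Jvec e)) (n₀ q) :=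
      ((hFτ.differentiable (by norm_num)) _).hasFDerivAt.comp_hasDerivAt (n₀ q) hl
    rw [← h2.deriv]; exact hd
  refine ⟨n₀, hspec, fun q h1 h2 => hcritF q ⟨h1, h2⟩, fun m q h1 h2 => ?_⟩
  -- smoothness: the `C^m` implicit function theorem at a non-degenerate critical point
  have hq : q ∈ V := ⟨h1, h2⟩
  have hG : ∀ p ∈ V, ∀ n' ∈ Ioo (-r) r, ContDiffAt ℝ (m + 1) (fun v : (ℝ × ℝ × ℝ) × ℝ => F v.1.1 (frameCLM e (v.1.2.1, v.2, v.1.2.2))) (p, n') :=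
    fun p hp n' _ => contDiffAt_timeSection hT hF (hT' p hp) n'
  have hconcG : ∀ p ∈ V, ∀ n' ∈ Ioo (-r) r, fderiv ℝ (fderiv ℝ (fun v : (ℝ × ℝ × ℝ) × ℝ => F v.1.1 (frameCLM e (v.1.2.1, v.2, v.1.2.2)))) (p, n')
      ((0 : ℝ × ℝ × ℝ), (1 : ℝ)) ((0 : ℝ × ℝ × ℝ), (1 : ℝ)) < 0 := by
    intro p hp n' hn'
    rw [fderiv_fderiv_timeSection_fibre hT hF (hT' p hp) n']
    exact hconc p.1 p.2.2 hp.1 hp.2 p.2.1 n' hn'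
  have hn₀V : ∀ p ∈ V, n₀ p ∈ Ioo (-r) r := fun p hp => (hspec p hp.1 hp.2).1
  have hcrit : ∀ p ∈ V, fderiv ℝ (fun v : (ℝ × ℝ × ℝ) × ℝ => F v.1.1 (frameCLM e (v.1.2.1, v.2, v.1.2.2))) (p, n₀ p) ((0 : ℝ × ℝ × ℝ), (1 : ℝ)) = 0 := by
    intro p hp
    rw [fderiv_timeSection_fibre hT hF (hT' p hp) (n₀ p)]
    exact hcritF p hp
  have hm0 : (m : ℕ∞ω) ≠ 0 ∨ (m : ℕ∞ω) = 0 := by by_cases h : (m : ℕ∞ω) = 0 <;> simp [h]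
  rcases hm0 with hm0 | hm0
  · exact contDiffAt_criticalPoint_of_contDiffAt hVo hm0 le_rfl hG hconcG hn₀V hcrit hq
  · -- `m = 0`: continuity follows from the `C¹` case
    have h1' : ContDiffAt ℝ 1 n₀ q := by
      have hG1 : ∀ p ∈ V, ∀ n' ∈ Ioo (-r) r, ContDiffAt ℝ ((1 : ℕ∞) + 1) (fun v : (ℝ × ℝ × ℝ) × ℝ => F v.1.1 (frameCLM e (v.1.2.1, v.2, v.1.2.2))) (p, n') :=
        fun p hp n' _ => contDiffAt_timeSection hT hF (hT' p hp) n'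
      exact contDiffAt_criticalPoint_of_contDiffAt hVo (by simp) le_rfl hG1 hconcG hn₀V hcrit hq
    rw [hm0]
    exact h1'.of_le (by simp)

/-- The inclusion of the slice `τ` into space–time parameters: `p ↦ (τ, p)` has derivative `h ↦ (0, h)`. -/
theorem hasFDerivAt_sliceIncl (τ : ℝ) (p : ℝ × ℝ) :
    HasFDerivAt (fun p : ℝ × ℝ => ((τ, p) : ℝ × ℝ × ℝ)) ((ContinuousLinearMap.inr ℝ ℝ (ℝ × ℝ))) p := by
  have h : HasFDerivAt (fun p : ℝ × ℝ => ((τ, p) : ℝ × ℝ × ℝ)) ((0 : ℝ × ℝ →L[ℝ] ℝ).prod (ContinuousLinearMap.id ℝ (ℝ × ℝ))) p :=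
    (hasFDerivAt_const τ p).prodMk (hasFDerivAt_id p)
  convert h using 1
  ext <;> simp

/-- **Slice Hessians depend continuously on time:** for `F` jointly smooth on the open time set `T`, a map `g` continuous at `w₀` with `w₀.1 ∈ T`, and fixed
directions `a, b`: `w ↦ D²(F w.1)(g w)[a, b]` is continuous at `w₀` (the slice Hessian is the spatial block of the space–time Hessian,
`…FlatRidgeMixedPin.fderiv_fderiv_slice_apply`). -/
theorem continuousAt_sliceHessian (hT : IsOpen T) (hF : IsSmoothSpaceTimeOn T F) {g : ℝ × ℝ → EuclideanSpace ℝ (Fin 3)} {w₀ : ℝ × ℝ}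
    (hw₀ : w₀.1 ∈ T) (hg : ContinuousAt g w₀) (a b : EuclideanSpace ℝ (Fin 3)) :
    ContinuousAt (fun w : ℝ × ℝ => fderiv ℝ (fderiv ℝ (F w.1)) (g w) a b) w₀ := by
  have hD2c : ContinuousOn (fderiv ℝ (fderiv ℝ (uncurry F))) (T ×ˢ (univ : Set (EuclideanSpace ℝ (Fin 3)))) :=
    ((hF.fderiv_of_isOpen (hT.prod isOpen_univ) (m := ∞) le_rfl).fderiv_of_isOpen (hT.prod isOpen_univ) (m := ∞) le_rfl).continuousOn
  have hWc : ContinuousAt (fun w : ℝ × ℝ => ((w.1, g w) : ℝ × EuclideanSpace ℝ (Fin 3))) w₀ := continuousAt_fst.prodMk hg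
  have hmem : ((w₀.1, g w₀) : ℝ × EuclideanSpace ℝ (Fin 3)) ∈ T ×ˢ (univ : Set (EuclideanSpace ℝ (Fin 3))) := ⟨hw₀, mem_univ _⟩
  have hB : ContinuousAt (fun w : ℝ × ℝ => fderiv ℝ (fderiv ℝ (uncurry F)) (w.1, g w)) w₀ :=
    ContinuousAt.comp_of_eq (hD2c.continuousAt ((hT.prod isOpen_univ).mem_nhds hmem)) hWc rfl
  have hBab : ContinuousAt (fun w : ℝ × ℝ => fderiv ℝ (fderiv ℝ (uncurry F)) (w.1, g w) ((0 : ℝ), a) ((0 : ℝ), b)) w₀ :=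
    (hB.clm_apply continuousAt_const).clm_apply continuousAt_const
  refine hBab.congr ?_
  have hnear : ∀ᶠ w : ℝ × ℝ in 𝓝 w₀, w.1 ∈ T := continuousAt_fst.preimage_mem_nhds (hT.mem_nhds hw₀)
  filter_upwards [hnear] with w hw
  have hF2 : ContDiff ℝ 2 (F w.1) := (hF.contDiff_slice hw).of_le (by exact WithTop.coe_le_coe.2 le_top)
  rw [← nested_eq_fderiv_fderiv hF2, fderiv_fderiv_slice_apply hF hT hw]

/-- **Slice Hessian entries along a differentiable curve are differentiable:** `z ↦ D²(F τ)(g z)[a,b]` for `τ ∈ T` and `g` differentiable at `z`. -/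
theorem differentiableAt_sliceHessian_comp (hF : IsSmoothSpaceTimeOn T F) {τ : ℝ} (hτ : τ ∈ T) {g : ℝ → EuclideanSpace ℝ (Fin 3)} {z : ℝ}
    (hg : DifferentiableAt ℝ g z) (a b : EuclideanSpace ℝ (Fin 3)) :
    DifferentiableAt ℝ (fun z' : ℝ => fderiv ℝ (fderiv ℝ (F τ)) (g z') a b) z := by
  have hF2ω : ContDiff ℝ ∞ (fderiv ℝ (fderiv ℝ (F τ))) :=
    ((hF.contDiff_slice hτ).fderiv_right (m := ∞) le_rfl).fderiv_right (m := ∞) le_rfl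
  have h1 : DifferentiableAt ℝ (fderiv ℝ (fderiv ℝ (F τ)) ∘ g) z := (hF2ω.differentiable (by simp) _).comp z hg
  exact (h1.clm_apply (differentiableAt_const a)).clm_apply (differentiableAt_const b)

end ClassFree

/-! ### Part A′ — class level, per time: the frame trace and the slice law of the signed component `σU₂(−1+τ,·)` -/

variable {C : ℝ} {U : ℝ → EuclideanSpace ℝ (Fin 3) → EuclideanSpace ℝ (Fin 3)} {μ : ℝ → ℝ → ℝ} {σ ρ : ℝ} {e : EuclideanSpace ℝ (Fin 3)}

/-- The vertical component of a class profile is `C²` on every slice `t = −1 + τ`, `|τ| < 1/2`. -/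
theorem contDiff_two_vert_at (hUrate : HasTypeITimeDecay C U) (hUcont : ContinuousOn (uncurry U) (Iio (0 : ℝ) ×ˢ univ))
    (hUmild : ∀ s t : ℝ, s < t → t < 0 → ∀ x, U t x = heatExtension (U s) (t - s) x - oseenDuhamel 1 s U U t x)
    (hUdiv : ∀ t < 0, VectorCalculus.IsDivFree (U t)) {τ : ℝ} (hτ : |τ| < 1 / 2) :
    ContDiff ℝ 2 (fun y => U (-1 + τ) y 2) := by
  have ht : -1 + τ < 0 := by linarith [(abs_lt.1 hτ).2]
  have hU2 : ContDiff ℝ 2 (U (-1 + τ)) := contDiff_slice_of_class hUrate hUcont hUmild hUdiv ht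
  exact PoloidalWindowDoorPoloidalWindowRigidityConstantShearMeans.contDiff_coord hU2 2

/-- **Frame trace at time `−1+τ`:** `D²(σU₂(−1+τ,·))(x)[e,e] + D²(σU₂(−1+τ,·))(x)[Je,Je] = σ·(∂₀²U₂ + ∂₁²U₂)(x)` for a horizontal unit vector `e`. -/
theorem frame_trace_at (hUrate : HasTypeITimeDecay C U) (hUcont : ContinuousOn (uncurry U) (Iio (0 : ℝ) ×ˢ univ))
    (hUmild : ∀ s t : ℝ, s < t → t < 0 → ∀ x, U t x = heatExtension (U s) (t - s) x - oseenDuhamel 1 s U U t x)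
    (hUdiv : ∀ t < 0, VectorCalculus.IsDivFree (U t)) (he2 : e 2 = 0) (hunit : e 0 ^ 2 + e 1 ^ 2 = 1) {τ : ℝ} (hτ : |τ| < 1 / 2)
    (x : EuclideanSpace ℝ (Fin 3)) :
    fderiv ℝ (fderiv ℝ (fun y => σ * U (-1 + τ) y 2)) x e e + fderiv ℝ (fderiv ℝ (fun y => σ * U (-1 + τ) y 2)) x (Jvec e) (Jvec e) =
      σ * (fderiv ℝ (fun w => fderiv ℝ (fun y => U (-1 + τ) y 2) w (EuclideanSpace.single 0 (1 : ℝ))) x (EuclideanSpace.single 0 (1 : ℝ)) +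
        fderiv ℝ (fun w => fderiv ℝ (fun y => U (-1 + τ) y 2) w (EuclideanSpace.single 1 (1 : ℝ))) x (EuclideanSpace.single 1 (1 : ℝ))) := by
  have hθ2 := contDiff_two_vert_at hUrate hUcont hUmild hUdiv hτ
  have hF2 : ContDiff ℝ 2 (fun y => σ * U (-1 + τ) y 2) := contDiff_const.mul hθ2
  rw [bilin_frame_trace (fderiv ℝ (fderiv ℝ (fun y => σ * U (-1 + τ) y 2)) x) he2 hunit, ← nested_eq_fderiv_fderiv hF2, ← nested_eq_fderiv_fderiv hF2,
    nested_const_mul hθ2, nested_const_mul hθ2]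
  ring

/-- **Slice law at time `−1+τ` on the slope slab:** `D²(σU₂)(x)[e₂,e₂] = −μ(−1+τ, x₂)·(D²(σU₂)(x)[e,e] + D²(σU₂)(x)[Je,Je])` for `|τ| < ρ`, `|x₂| < ρ`
(`…TimeHeightShearLinearSlice.plane_wave_identity` + incompressibility). -/
theorem slice_law_at (hUrate : HasTypeITimeDecay C U) (hUcont : ContinuousOn (uncurry U) (Iio (0 : ℝ) ×ˢ univ))
    (hUmild : ∀ s t : ℝ, s < t → t < 0 → ∀ x, U t x = heatExtension (U s) (t - s) x - oseenDuhamel 1 s U U t x)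
    (hUdiv : ∀ t < 0, VectorCalculus.IsDivFree (U t)) (he2 : e 2 = 0) (hunit : e 0 ^ 2 + e 1 ^ 2 = 1) {τ : ℝ} (hτ : |τ| < 1 / 2) (hτρ : |τ| < ρ)
    (hslabU : ∀ t : ℝ, |t + 1| < ρ → ∀ x : EuclideanSpace ℝ (Fin 3), |x 2| < ρ → ∀ b : Fin 3, b ≠ 2 →
      fderiv ℝ (U t) x (EuclideanSpace.single 2 1) b = μ t (x 2) * fderiv ℝ (U t) x (EuclideanSpace.single b 1) 2)
    {x : EuclideanSpace ℝ (Fin 3)} (hx : |x 2| < ρ) :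
    fderiv ℝ (fderiv ℝ (fun y => σ * U (-1 + τ) y 2)) x e2 e2 =
      -μ (-1 + τ) (x 2) * (fderiv ℝ (fderiv ℝ (fun y => σ * U (-1 + τ) y 2)) x e e +
        fderiv ℝ (fderiv ℝ (fun y => σ * U (-1 + τ) y 2)) x (Jvec e) (Jvec e)) := by
  have ht : -1 + τ < 0 := by linarith [(abs_lt.1 hτ).2]
  have hU2 : ContDiff ℝ 2 (U (-1 + τ)) := contDiff_slice_of_class hUrate hUcont hUmild hUdiv ht
  have hθ2 := contDiff_two_vert_at hUrate hUcont hUmild hUdiv hτ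
  have hF2 : ContDiff ℝ 2 (fun y => σ * U (-1 + τ) y 2) := contDiff_const.mul hθ2
  have hplane : ∀ y : EuclideanSpace ℝ (Fin 3), y 2 = x 2 → ∀ b : Fin 3, b ≠ 2 →
      fderiv ℝ (U (-1 + τ)) y (EuclideanSpace.single 2 (1 : ℝ)) b = μ (-1 + τ) (x 2) * fderiv ℝ (U (-1 + τ)) y (EuclideanSpace.single b (1 : ℝ)) 2 := by
    intro y hy b hb
    have h := hslabU (-1 + τ) (by simpa using hτρ) y (by rw [hy]; exact hx) b hb
    rw [hy] at h; exact h
  have hpw := plane_wave_identity hU2 (fun y => div_coord (hUdiv (-1 + τ) ht) y) hplane (x := x) rfl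
  rw [frame_trace_at hUrate hUcont hUmild hUdiv he2 hunit hτ, ← nested_eq_fderiv_fderiv hF2, show e2 = EuclideanSpace.single 2 (1 : ℝ) from rfl,
    nested_const_mul hθ2, hpw]
  ring

end Summit.NavierStokesRegularity.NavierStokesRegularity.Theorems.PoloidalWindowDoorLrcModEntireQ4TimeWebFunction

end
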